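import Literature.AnabelianGeometry.EtaleTheta.SettingModelGfpRigidity
import Literature.AnabelianGeometry.EtaleTheta.SettingModel2CommutatorCusp
import HarnessLib

/-!
# The Heisenberg LEVEL SHADOW of a cusp-scaling endomorphism of `F̂₂`: `x ↦ x`, `y ↦ k·x + u·y`

Mochizuki, *The étale theta function …*, Publ. RIMS **45** (2009) [EtTh], §1 pp. 12–13 [cite: MochizukiEtTh2009, §1 p.13]: «`(Δ^tp_Y)^ell ≅ Ẑ(1)`»,
«`Δ_Θ ≅ Ẑ(1)`», «`G_{K_N}` acts trivially on `(Δ^tp_X)^ell/N·(Δ^tp_Y)^ell`» — the Galois action on the class-`2` quotient of `Δ_X` is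
upper-triangular with the cyclotomic character on the diagonal entry of `b` and of `⁅a,b⁆`, and a Kummer-type off-diagonal entry.
Cell abc-iut, layer L2 (NV lane), seat abc-iut-L2-t5 (gen 7): the ONE non-obvious shape recorded under abc-iut-L2-lead's G-row G-L2t5-1
(«CuspTwistAction»: `ρ σ ∈ Aut_cont(F̂₂)`, `ê ∘ ρ σ = ê`, `ρ σ (c^t) = c^{χ(σ)t}`) made a KERNEL statement about ANY such endomorphism,
over abc-iut-w5-d051's `hHat_y_apply_eq` (`y(ĥ_N(Φ x)) = c₁ x + c₂ y`, BY NAME) and abc-iut-w5-d165's `cPow`/`hHat_cPow`. PROOF-ONLY.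

RESULTS, for a continuous endomorphism `Φ` of `F̂₂` with `ê ∘ Φ = ê` (`hê`) and `Φ(η⁅a,b⁆) = c^u` (`hc`, `u ∈ Ẑ`):
* `hHat_x_apply_eq_of_eHat` — the `x`-row is `(1, 0)`: `x(ĥ_N(Φ g)) = x(ĥ_N g)`;
* `hHat_commutator_eta_z` — `z(ĥ_N ⁅g, h⁆) = x(g)·y(h) − x(h)·y(g)`;
* **`hHat_y_coeff_eq_level`** — the diagonal entry of `b` IS the cusp scalar: `c₂ = y(ĥ_N(Φ(η b))) = u mod N`
  (the `z`-coordinate of `Φ⁅a,b⁆ = ⁅Φa, Φb⁆` is `x(Φa)·y(Φb) − x(Φb)·y(Φa) = 1·c₂ − 0`);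
* **`hHat_y_apply_eq_of_cuspScaling`** — the level-`N` shadow of `Φ` on `(x, y)` is `x ↦ x`, `y ↦ k_N·x + u_N·y` with
  `k_N := y(ĥ_N(Φ(η a)))` (for `Φ = ρ(σ)` this `k` is a `χ`-cocycle in `σ` — the Kummer class of `q` at a genuine Tate curve; not
  formalised here);
* `hHat_y_apply_eq_of_cuspScaling_of_eHat_eq_one` — on `Ker ê`: `y ↦ u_N·y` (so `Φ` preserves every `Δ^tp_{Y_N} ∩ Ker ê`-level
  condition `y ≡ 0` when `u` is a unit mod `N`: `hHat_y_eq_zero_iff_of_cuspScaling`).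
Classical profinite bookkeeping under OUR kernel check; nothing of [EtTh] asserted; no side taken on [IUTchIII] Cor. 3.12; typed ≠ proved.
-/

noncomputable section

namespace Literature.AnabelianGeometry.EtaleTheta.SettingModel

open Literature.AnabelianGeometry.SemiGraphs Function
open scoped commutatorElement

/-- **The `x`-row of the level shadow is `(1, 0)`** for `Φ` with `ê ∘ Φ = ê`. [cite: MochizukiEtTh2009, §1 p.13] -/
theorem hHat_x_apply_eq_of_eHat (Φ : F₂hatT →ₜ* F₂hatT) (hê : ∀ g, eHat (Φ g) = eHat g) (N : ℕ+) (g : F₂hatT) :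
    (hHat N (Φ g)).x = (hHat N g).x := by
  apply Multiplicative.ofAdd.injective
  rw [hHat_x_eq_modN_eHat, hHat_x_eq_modN_eHat, hê]

/-- The `z`-coordinate of a commutator at level `N`: `z(ĥ_N⁅g,h⁆) = x(g)y(h) − x(h)y(g)`. [cite: MochizukiEtTh2009, §1 p.12] -/
theorem hHat_commutator_z (N : ℕ+) (g h : F₂hatT) :
    (hHat N ⁅g, h⁆).z = (hHat N g).x * (hHat N h).y - (hHat N h).x * (hHat N g).y := by
  rw [map_commutatorElement, Heis.commutatorElement_eq]

/-- `ĥ_N(η⁅a,b⁆) = ĥ_N(c^{ι 1})`. [cite: MochizukiEtTh2009, §1 p.12] -/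
theorem eta_cElt_eq_cPow : eta cElt = cPow (iotaZ (Multiplicative.ofAdd 1)) := cPow_spec.symm

/-- **The diagonal entry of `b` is the cusp scalar**: if `ê ∘ Φ = ê` and `Φ(η⁅a,b⁆) = c^u` then `y(ĥ_N(Φ(η b))) = u mod N`.
[cite: MochizukiEtTh2009, §1 p.13] -/
theorem hHat_y_coeff_eq_level (Φ : F₂hatT →ₜ* F₂hatT) (hê : ∀ g, eHat (Φ g) = eHat g) {u : ZH} (hc : Φ (eta cElt) = cPow u)
    (N : ℕ+) : (hHat N (Φ (eta (FreeGroup.of 1)))).y = Multiplicative.toAdd (modN N u) := by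
  -- `z(ĥ_N Φ⁅a,b⁆) = x(Φa)·y(Φb) − x(Φb)·y(Φa) = 1·c₂ − 0·c₁`
  have hz : (hHat N (Φ (eta cElt))).z = (hHat N (Φ (eta (FreeGroup.of 1)))).y := by
    rw [cElt, map_commutatorElement eta, map_commutatorElement Φ, hHat_commutator_z, hHat_x_apply_eq_of_eHat Φ hê, hHat_x_apply_eq_of_eHat Φ hê, hHat_eta, hHat_eta, heisHom_of_zero,
      heisHom_of_one, Heis.map_apply, Heis.map_apply]
    simp
  rw [← hz, hc, hHat_cPow]

/-- **The level-`N` shadow of a cusp-scaling, `ê`-preserving endomorphism is `x ↦ x`, `y ↦ k_N·x + u_N·y`**, `k_N := y(ĥ_N(Φ(η a)))`.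
[cite: MochizukiEtTh2009, §1 p.13] -/
theorem hHat_y_apply_eq_of_cuspScaling (Φ : F₂hatT →ₜ* F₂hatT) (hê : ∀ g, eHat (Φ g) = eHat g) {u : ZH}
    (hc : Φ (eta cElt) = cPow u) (N : ℕ+) (g : F₂hatT) :
    (hHat N (Φ g)).y = (hHat N (Φ (eta (FreeGroup.of 0)))).y * (hHat N g).x + Multiplicative.toAdd (modN N u) * (hHat N g).y := by
  rw [hHat_y_apply_eq Φ N g, hHat_y_coeff_eq_level Φ hê hc N]

/-- On `Ker ê` the shadow is the scalar `u`: `y(ĥ_N(Φ k)) = u_N · y(ĥ_N k)`. [cite: MochizukiEtTh2009, §1 p.13] -/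
theorem hHat_y_apply_eq_of_cuspScaling_of_eHat_eq_one (Φ : F₂hatT →ₜ* F₂hatT) (hê : ∀ g, eHat (Φ g) = eHat g) {u : ZH}
    (hc : Φ (eta cElt) = cPow u) (N : ℕ+) {k : F₂hatT} (hk : eHat k = 1) :
    (hHat N (Φ k)).y = Multiplicative.toAdd (modN N u) * (hHat N k).y := by
  rw [hHat_y_apply_eq_of_cuspScaling Φ hê hc N k, hHat_x_eq_zero_of_eHat_eq_one N hk, mul_zero, zero_add]

/-- When the cusp scalar is a unit mod `N` (e.g. `u = φ(ι 1)` for `φ ∈ Aut(Ẑ) = Ẑ^×`), the level condition `y ≡ 0 (mod N)` on `Ker ê` is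
`Φ`-invariant (every `Δ^tp_{Y_N}`-type level set is preserved). [cite: MochizukiEtTh2009, §1 p.13] -/
theorem hHat_y_eq_zero_iff_of_cuspScaling (Φ : F₂hatT →ₜ* F₂hatT) (hê : ∀ g, eHat (Φ g) = eHat g) {u : ZH}
    (hc : Φ (eta cElt) = cPow u) (N : ℕ+) (hu : IsUnit (Multiplicative.toAdd (modN N u))) {k : F₂hatT} (hk : eHat k = 1) :
    (hHat N (Φ k)).y = 0 ↔ (hHat N k).y = 0 := by
  rw [hHat_y_apply_eq_of_cuspScaling_of_eHat_eq_one Φ hê hc N hk]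
  exact hu.mul_right_eq_zero

end Literature.AnabelianGeometry.EtaleTheta.SettingModel

end
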